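import Summits.HubbardSuperconductivity.HubbardLadder.Bounds.ThermalMottStiffnessCeiling
import Summits.HubbardSuperconductivity.HubbardLadder.Bounds.HoppingFormBandBound
import HarnessLib


/-!
# Hubbard ladder — Bounds: the CANONICAL structure-factor ceilings of the Hubbard torus at EVERY
# wave vector, `T > 0` — UNCONDITIONAL (bounds.tex Cor. 11.3; typed AND proved)

HONEST FRAMING (cell pub-hubbard): ladder R1–R4 with certified numbers; no claim on H/H₀. These
are bounds for MODEL CLASSES — the pure-hopping Hubbard model `hubbardTorusTT' L 1 0 U` on the
torus `(ℤ/Lℤ)²` (degree `4`): attractive (`U < 0`, every `L ≥ 1`, the `(2m, S^z = 0)` coordinate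
sector of #106, every `m ≤ L²`) and repulsive (`U > 0`, even `L`, the half-filled `(L², S^z = 0)`
sector of #158); `β > 0`; no materials claim. The graph-general statements and the band bound are
in `HoppingFormBandBound.lean`. Text: `pub-hubbard/paper/bounds.tex` Cor. 11.3, Remark 11; tables
`pub-hubbard/pub-hubbard-bounds/BOUNDS.md` (row T9ᵇ) and `EXTREMISERS.md` §5u.

## What is proved (no `sorry`, no new axioms, no named-fact hypothesis)

* `card_filter_adj_fermionTorusGraph_le` — every site of `(ℤ/Lℤ)²` has at most `4` neighbours.
* Nodes (`@[conjecture] def`, each proved by `…_holds`):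
  `ThermalAttractiveSDWCeilingCanonicalAllQ` — every `L ≥ 1`, `U < 0`, `T > 0`, `m ≤ L²`,
  `|a| ≤ 1`: `Re⟨(M_a|_p)²⟩_{β,p} ≤ Σa² T/|U| + ½ √(Σa²/|U| · 32 m)`; per site with `Σa² ≤ L²`,
  `n = 2m/L²`: `4 S^{zz}_{β,p}(q) ≤ T/|U| + 2 √(n/|U|)` (Kubo–Kishi (A3) × density, canonically);
  `ThermalMottCDWCeilingCanonicalAllQ` — even `L`, `U > 0`, `T > 0`, `|a| ≤ 1`, half filling:
  `Re⟨(N_a|_p)²⟩_{β,p} ≤ Σa² T/U + ½ √(Σa²/U · 16 L²)`; per site `S^{cc}_{β,p}(q) ≤ T/U + 2/√U`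
  — Kubo–Kishi's (5) verbatim, in the canonical ensemble.

Honest numbers: informative only for `|U| ≳ 16 t` (`U ≳ 16 t`); for `q = Q = (π, π)` the
kinetic-energy route of rows T9ᶜ / T9ᵃ (#173 / #174) is sharper in the strong-coupling windows.
Finite volume, fixed particle numbers; the thermodynamic limit and `T = 0` are not addressed.
References (`lean/references.bib`): KuboKishi1990 Thms 1–2, eqs. (3)–(5), Remark 3; LiebPRL1989
Thms 1–2; DLS1978 Lemma 4.1, Thm 3.1.
-/


noncomputable section

namespace Summit.HubbardSuperconductivity.HubbardLadder.Bounds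

open Matrix Finset Real
open Literature.MathematicalPhysics.QuantumLattice
open Literature.MathematicalPhysics.QuantumFieldTheory
open Literature.Probability.LatticeModels
open scoped ComplexOrder ComplexConjugate

/-! ### The torus `(ℤ/Lℤ)²`: degree `4`, the canonical sectors of #106 / #158 -/

section Torus

variable {L : ℕ} [NeZero L]

/-- The torus graph `(ℤ/Lℤ)²` with nearest-neighbour bonds. -/
local notation "Gᴸ" => fermionTorusGraph 2 L

/-- Every site of the torus `(ℤ/Lℤ)²` has at most `4` neighbours (`x ± e₁`, `x ± e₂`). -/
theorem card_filter_adj_fermionTorusGraph_le (u : FermionTorus 2 L) :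
    (univ.filter ((Gᴸ).Adj u)).card ≤ 4 := by
  classical
  have hsub : univ.filter ((Gᴸ).Adj u) ⊆
      (univ : Finset (Fin 2)).image
          (fun i => FermionTorus.ofTorusSite (u.toTorusSite + Pi.single i 1)) ∪
        (univ : Finset (Fin 2)).image
          (fun i => FermionTorus.ofTorusSite (u.toTorusSite - Pi.single i 1)) := by
    intro v hv
    simp only [Finset.mem_filter, Finset.mem_univ, true_and, fermionTorusGraph_adj,
      torusGraph_adj_iff] at hv
    obtain ⟨-, ⟨i, h⟩ | ⟨i, h⟩⟩ := hv
    · refine Finset.mem_union_left _ (Finset.mem_image.2 ⟨i, Finset.mem_univ _, ?_⟩)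
      rw [← h, FermionTorus.ofTorusSite_toTorusSite]
    · refine Finset.mem_union_right _ (Finset.mem_image.2 ⟨i, Finset.mem_univ _, ?_⟩)
      rw [h, add_sub_cancel_right, FermionTorus.ofTorusSite_toTorusSite]
  calc (univ.filter ((Gᴸ).Adj u)).card ≤ _ := Finset.card_le_card hsub
    _ ≤ ((univ : Finset (Fin 2)).image
            (fun i => FermionTorus.ofTorusSite (u.toTorusSite + Pi.single i 1))).card +
          ((univ : Finset (Fin 2)).image
            (fun i => FermionTorus.ofTorusSite (u.toTorusSite - Pi.single i 1))).card :=
        Finset.card_union_le _ _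
    _ ≤ (univ : Finset (Fin 2)).card + (univ : Finset (Fin 2)).card :=
        add_le_add Finset.card_image_le Finset.card_image_le
    _ = 4 := by simp

omit [NeZero L] in
/-- A configuration lies in the `(2m, S^z = 0)` coordinate sector iff it has `m` up and `m` down
electrons. -/
theorem mem_spinZeroSector_iff (s : Finset (Orb (FermionTorus 2 L))) (m : ℕ) :
    (s.card = 2 * m ∧ 2 * (s.filter fun i => (ofLex i).2 = 0).card = 2 * m) ↔
      (upPart s).card = m ∧ (downPart s).card = m := by
  refine ⟨fun h => ?_, fun h => spinZeroSector_of_card_upPart_downPart h⟩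
  have hu : (upPart s).card = m := by
    have h2 := h.2
    rw [card_filter_spin_zero_eq_card_upPart] at h2
    omega
  refine ⟨hu, ?_⟩
  have hc := card_eq_upPart_add_downPart s
  rw [h.1, hu] at hc
  omega

omit [NeZero L] in
/-- `H(1,U)` on the torus at `t' = 0` is `hamiltonianWith (fermionTorusGraph 2 L) 1 U 0`. -/
theorem hubbardTorusTT'_one_zero_eq_hamiltonianWith (U : ℝ) :
    hubbardTorusTT' L 1 0 U = hamiltonianWith Gᴸ 1 U 0 := by
  rw [hubbardTorusTT'_zero, hamiltonianWith_zero]; rfl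

/-- Node: **the canonical SDW / spin structure-factor ceiling of the attractive torus at EVERY wave
vector** (UNCONDITIONAL; the `(2m, S^z = 0)` sector of #106): for every `L ≥ 1`, `U < 0`, `T > 0`,
`m ≤ L²` and every profile `|a_x| ≤ 1` (e.g. `cos(q·x)`, `(-1)^x`),
`Re⟨(M_a|_p)²⟩_{β,p} ≤ Σa² T/|U| + ½ √(Σa²/|U| · 32 m)`; per site with `Σa² ≤ L²`, `n = 2m/L²`:
`4 S^{zz}_{β,p}(q) ≤ T/|U| + 2 √(n/|U|)`. kind: support (PROVED). Why it might fail: it cannot;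
at `n = 1` it is Kubo–Kishi's Remark-3 constant, informative only for `|U| ≳ 16 t`. Sources:
KuboKishi1990 Thm 1, Remark 3; LiebPRL1989 Thm 1; DLS1978 Thm 3.1; this cell (Cor. 11.3). -/
@[conjecture] def ThermalAttractiveSDWCeilingCanonicalAllQ : Prop :=
  ∀ (L : ℕ) [NeZero L] (U β : ℝ) (m : ℕ) (a : FermionTorus 2 L → ℝ), U < 0 → 0 < β → m ≤ L ^ 2 →
    (∀ x, |a x| ≤ 1) →
    let p : Finset (Orb (FermionTorus 2 L)) → Prop := fun s =>
      s.card = 2 * m ∧ 2 * (s.filter fun i => (ofLex i).2 = 0).card = 2 * m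
    (gibbsState β ((hubbardTorusTT' L 1 0 U).toBlock p p)
        ((spinDensityField a).toBlock p p * (spinDensityField a).toBlock p p)).re ≤
      (∑ x, a x ^ 2) / (-U) / β + 1 / 2 * Real.sqrt ((∑ x, a x ^ 2) / (-U) * (32 * m))

/-- **`ThermalAttractiveSDWCeilingCanonicalAllQ` holds.** -/
theorem thermalAttractiveSDWCeilingCanonicalAllQ_holds : ThermalAttractiveSDWCeilingCanonicalAllQ := by
  intro L _ U β m a hU hβ hm ha
  dsimp only
  set p : Finset (Orb (FermionTorus 2 L)) → Prop := fun s =>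
    s.card = 2 * m ∧ 2 * (s.filter fun i => (ofLex i).2 = 0).card = 2 * m with hp
  haveI : Nonempty {s // p s} := nonempty_spinZeroSector (L := L) hm
  have h := re_gibbsState_spinDensityField_sq_toBlock_le_allQ (G := fermionTorusGraph 2 L)
    (t := 1) (μ := 0)
    zero_le_one hU hβ (Δ := 4) card_filter_adj_fermionTorusGraph_le p
    (fun s => mem_spinZeroSector_iff s m) a ha
  rw [abs_of_neg hU, show (8 : ℝ) * 1 * ((4 : ℕ) : ℝ) * (m : ℝ) = 32 * m by norm_num] at h
  rw [hubbardTorusTT'_one_zero_eq_hamiltonianWith]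
  convert h using 4

/-- Node: **Kubo–Kishi (5) canonically at EVERY wave vector — the CDW / charge structure-factor
ceiling of the repulsive torus in the half-filled `(L², S^z = 0)` sector** (UNCONDITIONAL; the
sector of #158): for every even `L`, `U > 0`, `T > 0` and every profile `|a_x| ≤ 1`,
`Re⟨(N_a|_p)²⟩_{β,p} ≤ Σa² T/U + ½ √(Σa²/U · 16 L²)`; per site with `Σa² ≤ L²`:
`S^{cc}_{β,p}(q) ≤ T/U + 2/√U`. kind: support (PROVED). Why it might fail: it cannot; the constant
is Kubo–Kishi's (degree form), so the row is informative only for `U ≳ 16 t`; for `q = Q` row T9ᶜ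
(#173) is sharper. Sources: KuboKishi1990 Thm 2 eq. (5), Remark 3; LiebPRL1989 Thm 2; DLS1978
Thm 3.1; this cell (Cor. 11.3). -/
@[conjecture] def ThermalMottCDWCeilingCanonicalAllQ : Prop :=
  ∀ (L : ℕ) [NeZero L], Even L → ∀ (U β : ℝ) (a : FermionTorus 2 L → ℝ), 0 < U → 0 < β →
    (∀ x, |a x| ≤ 1) →
    let p : Finset (Orb (FermionTorus 2 L)) → Prop := fun s =>
      s.card = L ^ 2 ∧ 2 * (s.filter fun i => (ofLex i).2 = 0).card = L ^ 2
    (gibbsState β ((hubbardTorusTT' L 1 0 U).toBlock p p)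
        ((chargeDensityField a).toBlock p p * (chargeDensityField a).toBlock p p)).re ≤
      (∑ x, a x ^ 2) / U / β + 1 / 2 * Real.sqrt ((∑ x, a x ^ 2) / U * (16 * (L : ℝ) ^ 2))

/-- **`ThermalMottCDWCeilingCanonicalAllQ` holds.** -/
theorem thermalMottCDWCeilingCanonicalAllQ_holds : ThermalMottCDWCeilingCanonicalAllQ := by
  intro L _ hLe U β a hU hβ ha
  dsimp only
  set p : Finset (Orb (FermionTorus 2 L)) → Prop := fun s =>
    s.card = L ^ 2 ∧ 2 * (s.filter fun i => (ofLex i).2 = 0).card = L ^ 2 with hp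
  haveI : Nonempty {s // p s} := nonempty_halfFilledSector (L := L) hLe
  have hL2e : 2 * (L ^ 2 / 2) = L ^ 2 :=
    Nat.two_mul_div_two_of_even (Nat.even_pow.2 ⟨hLe, two_ne_zero⟩)
  have hcard : Fintype.card (FermionTorus 2 L) = L ^ 2 := by simp [FermionTorus]
  have hkl : L ^ 2 / 2 + L ^ 2 / 2 = Fintype.card (FermionTorus 2 L) := by rw [hcard]; omega
  have hpiff : ∀ s, p s ↔ (upPart s).card = L ^ 2 / 2 ∧ (downPart s).card = L ^ 2 / 2 := by
    intro s
    rw [← mem_spinZeroSector_iff s (L ^ 2 / 2), hL2e]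
  have hε : ∀ x y : FermionTorus 2 L, (fermionTorusGraph 2 L).Adj x y →
      torusStagger (d := 2) (L := L) x = -torusStagger y :=
    fun _ _ h => torusStagger_eq_neg_of_adj_holds hLe h
  have h := re_gibbsState_chargeDensityField_sq_toBlock_le_allQ (G := fermionTorusGraph 2 L) _ hε
    (t := 1) zero_le_one hU hβ (Δ := 4) card_filter_adj_fermionTorusGraph_le hkl p hpiff a ha
  rw [hcard, show (4 : ℝ) * 1 * ((4 : ℕ) : ℝ) * ((L ^ 2 : ℕ) : ℝ) = 16 * (L : ℝ) ^ 2 by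
    push_cast; ring] at h
  rw [hubbardTorusTT'_one_zero_eq_hamiltonianWith, hamiltonianWith_zero]
  convert h using 4

end Torus


end Summit.HubbardSuperconductivity.HubbardLadder.Bounds

end
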